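import Summits.NavierStokesRegularity.NavierStokesRegularity.Theorems.QuietScarPocketDoorLPocketDefs
import Literature.Analysis.FluidPDE.HelicityDensityTransport

/-!
# QuietScarPocketDoorLCombRigidity — §B «L-pocket schema» (texts `QuietScarPocketDoorLPocketDefs`, nsreg-p1 g25 Sketch31D
# 8bb56c0a84466268), plate (P6): `combRigidity_holds : CombRigidity`

Seat nsreg-C26-p1 g4 (S-door lane, LEAD ns-s30-p1 g2; DIRECTOR-NS #209 (2)); `--supports stmt-NavierStokesRegularity-0056 --as helper`.

Instance `L = combCLM e` («COMBED pocket»: the part of the vorticity orthogonal to `e` is small).  The static rigidity input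
`CombRigidity := ∀ e, ‖e‖ = 1 → StaticLRigidity (combCLM e)`: a real-analytic field `V` on `ℝ³∖{0}` with Type-I decay of `∇V`
whose vorticity is everywhere PARALLEL to `e` off the apex (`ω = ⟪e,ω⟫ e`, `ω = curl V`) is irrotational off the apex.
Proof: `div ω = 0` (`divergence_curl_eq_zero_of_contDiffAt`) reads `∂ₑ⟪e,ω⟫ = 0`, i.e. `∂ₑ ω = 0` off the apex; `ω` decays like
`‖curlCLM‖·C/‖y‖² ≤ ‖curlCLM‖·C/‖y‖` for `‖y‖ ≥ 1`; so the half-line lemma (`eq_zero_offApex_of_fderiv_apply_eq_zero_of_farDecay`,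
the twin of (P5)'s with decay only at infinity) gives `ω ≡ 0` off the apex.  Only the gradient decay and the comb constraint are used.

WHAT THIS IS NOT: a static calculus lemma for a corollary schema about HYPOTHETICAL Type-I profiles (vorticity-direction theme on
ONE slice); item 0056 `NoTypeII` and Navier–Stokes regularity are NOT proved. [folklore]
-/

noncomputable section

set_option linter.dupNamespace false

namespace Summit.NavierStokesRegularity.NavierStokesRegularity.Theorems.QuietScarPocketDoor

open Set Function Filter Topology Metric
open scoped RealInnerProductSpace InnerProductSpace
open Literature.Analysis Literature.Analysis.FluidPDE

/-- **Half-line lemma with decay at infinity only**: if `W` is differentiable at every `y ≠ 0`, `‖W(y)‖ ≤ C/‖y‖` for `‖y‖ ≥ 1`,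
`e ≠ 0` and `∇W(y) e = 0` for all `y ≠ 0`, then `W ≡ 0` off the apex. [folklore] -/
theorem eq_zero_offApex_of_fderiv_apply_eq_zero_of_farDecay {W : EuclideanSpace ℝ (Fin 3) → EuclideanSpace ℝ (Fin 3)}
    {e : EuclideanSpace ℝ (Fin 3)} (he : e ≠ 0)
    (hdiff : ∀ y : EuclideanSpace ℝ (Fin 3), y ≠ 0 → DifferentiableAt ℝ W y)
    (hW : ∃ C : ℝ, ∀ y : EuclideanSpace ℝ (Fin 3), 1 ≤ ‖y‖ → ‖W y‖ ≤ C / ‖y‖)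
    (hL : ∀ y : EuclideanSpace ℝ (Fin 3), y ≠ 0 → fderiv ℝ W y e = 0)
    {y : EuclideanSpace ℝ (Fin 3)} (hy : y ≠ 0) : W y = 0 := by
  obtain ⟨C, hC⟩ := hW
  -- one of the two closed half-lines from `y` along `±e` misses the apex
  obtain ⟨e', he'e, hray⟩ : ∃ e' : EuclideanSpace ℝ (Fin 3), (e' = e ∨ e' = -e) ∧
      ∀ t : ℝ, 0 ≤ t → y + t • e' ≠ 0 := by
    by_contra h
    push Not at h
    obtain ⟨t₁, ht₁, h₁⟩ := h e (Or.inl rfl)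
    obtain ⟨t₂, ht₂, h₂⟩ := h (-e) (Or.inr rfl)
    have hsum : (t₁ + t₂) • e = 0 := by
      have : y + t₁ • e - (y + t₂ • -e) = 0 := by rw [h₁, h₂, sub_zero]
      rw [← this, smul_neg, add_smul]; abel
    rcases smul_eq_zero.1 hsum with h0 | h0
    · have ht₁0 : t₁ = 0 := by linarith
      rw [ht₁0, zero_smul, add_zero] at h₁
      exact hy h₁
    · exact he h0
  have he'0 : e' ≠ 0 := by rcases he'e with rfl | rfl <;> simp [he]
  have hL' : ∀ z : EuclideanSpace ℝ (Fin 3), z ≠ 0 → fderiv ℝ W z e' = 0 := by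
    intro z hz; rcases he'e with rfl | rfl
    · exact hL z hz
    · rw [map_neg, hL z hz, neg_zero]
  -- `t ↦ W(y + t e')` is constant on `[0, ∞)`
  set g : ℝ → EuclideanSpace ℝ (Fin 3) := fun t => W (y + t • e') with hg
  have hgd : ∀ t : ℝ, 0 ≤ t → HasDerivAt g 0 t := by
    intro t ht
    have hγ : HasDerivAt (fun s : ℝ => y + s • e') e' t := by
      simpa using ((hasDerivAt_id t).smul_const e').const_add y
    have hWd := (hdiff _ (hray t ht)).hasFDerivAt
    have := hWd.comp_hasDerivAt t hγ
    rwa [hL' _ (hray t ht)] at this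
  have hconst : ∀ t : ℝ, 0 ≤ t → g t = g 0 := by
    intro t ht
    have hc : ContinuousOn g (Icc 0 t) := fun s hs => (hgd s hs.1).continuousAt.continuousWithinAt
    exact constant_of_has_deriv_right_zero hc (fun s hs => (hgd s hs.1).hasDerivWithinAt) t
      ⟨ht, le_rfl⟩
  -- decay along the half-line (far out, where `‖y + t e'‖ ≥ 1`)
  have he'n : 0 < ‖e'‖ := norm_pos_iff.2 he'0
  have hnorm : ∀ t : ℝ, ‖y‖ + 1 ≤ t * ‖e'‖ → ‖W y‖ ≤ C / (t * ‖e'‖ - ‖y‖) := by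
    intro t ht
    have ht0 : 0 ≤ t := by
      by_contra h'
      have : t * ‖e'‖ < 0 := mul_neg_of_neg_of_pos (lt_of_not_ge h') he'n
      linarith [norm_nonneg y]
    have hlow : t * ‖e'‖ - ‖y‖ ≤ ‖y + t • e'‖ := by
      have h1 : ‖t • e'‖ ≤ ‖y + t • e'‖ + ‖y‖ := by
        have := norm_sub_le (y + t • e') y
        rwa [add_sub_cancel_left] at this
      rw [norm_smul, Real.norm_of_nonneg ht0] at h1
      linarith
    have hpos : 0 < t * ‖e'‖ - ‖y‖ := by linarith
    have hfar : 1 ≤ ‖y + t • e'‖ := by linarith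
    have key := hC _ hfar
    have hgy : W y = W (y + t • e') := by
      have := hconst t ht0
      simp only [hg, zero_smul, add_zero] at this
      exact this.symm
    rw [hgy]
    refine key.trans ?_
    by_cases hC0 : 0 ≤ C
    · exact div_le_div_of_nonneg_left hC0 hpos hlow
    · exfalso
      have : C / ‖y + t • e'‖ < 0 := div_neg_of_neg_of_pos (lt_of_not_ge hC0) (by linarith)
      linarith [norm_nonneg (W (y + t • e'))]
  have hlim : Tendsto (fun t : ℝ => C / (t * ‖e'‖ - ‖y‖)) atTop (𝓝 0) :=
    tendsto_const_nhds.div_atTop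
      (tendsto_atTop_add_const_right _ _ (tendsto_id.atTop_mul_const he'n))
  have hev : ∀ᶠ t : ℝ in atTop, ‖W y‖ ≤ C / (t * ‖e'‖ - ‖y‖) := by
    filter_upwards [eventually_ge_atTop ((‖y‖ + 1) / ‖e'‖)] with t ht
    exact hnorm t (by rwa [div_le_iff₀ he'n] at ht)
  exact norm_le_zero_iff.1 (ge_of_tendsto hlim hev)

/-- **(P6) COMB RIGIDITY** (`CombRigidity := ∀ e, ‖e‖ = 1 → StaticLRigidity (combCLM e)`): a real-analytic field on
`ℝ³∖{0}` with Type-I decay of its gradient whose vorticity is everywhere parallel to the fixed unit vector `e` off the apex is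
irrotational off the apex (`div curl = 0` makes `∂ₑ ω = 0`; half-line lemma + decay of `ω`). [folklore] -/
theorem combRigidity_holds : CombRigidity := by
  intro e he V hA _ hD _ hL y hy
  have he0 : e ≠ 0 := by
    intro h; rw [h, norm_zero] at he; exact zero_ne_one he
  have hopen : IsOpen ({0}ᶜ : Set (EuclideanSpace ℝ (Fin 3))) := isOpen_compl_singleton
  -- the vorticity `W = curl V` off the apex: parallel to `e`, differentiable, decaying
  set W : EuclideanSpace ℝ (Fin 3) → EuclideanSpace ℝ (Fin 3) := curl V with hW
  have hpar : ∀ z : EuclideanSpace ℝ (Fin 3), z ≠ 0 → W z = ⟪e, W z⟫ • e := by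
    intro z hz
    have h := hL z hz
    rw [combCLM_apply, sub_eq_zero] at h
    rw [hW, curl_eq_curlCLM]
    exact h
  have hC2 : ∀ z : EuclideanSpace ℝ (Fin 3), z ≠ 0 → ContDiffAt ℝ 2 V z := fun z hz => (hA z hz).contDiffAt
  have hDVd : ∀ z : EuclideanSpace ℝ (Fin 3), z ≠ 0 → DifferentiableAt ℝ (fderiv ℝ V) z := fun z hz =>
    ((hC2 z hz).fderiv_right (m := 1) (by norm_num)).differentiableAt (by norm_num)
  have hWd : ∀ z : EuclideanSpace ℝ (Fin 3), z ≠ 0 → DifferentiableAt ℝ W z := by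
    intro z hz
    rw [hW, curl_eq_curlCLM_comp]
    exact curlCLM.differentiableAt.comp z (hDVd z hz)
  -- decay of `W` at infinity from the gradient decay
  have hWdec : ∃ C : ℝ, ∀ z : EuclideanSpace ℝ (Fin 3), 1 ≤ ‖z‖ → ‖W z‖ ≤ C / ‖z‖ := by
    obtain ⟨C, hC⟩ := hD
    set κ : ℝ := ‖(curlCLM : (EuclideanSpace ℝ (Fin 3) →L[ℝ] EuclideanSpace ℝ (Fin 3)) →L[ℝ] EuclideanSpace ℝ (Fin 3))‖
      with hκ
    have hκ0 : 0 ≤ κ := by positivity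
    refine ⟨κ * |C|, fun z hz => ?_⟩
    have hz0 : z ≠ 0 := by
      intro h; rw [h, norm_zero] at hz; exact absurd hz (by norm_num)
    have hzn : 0 < ‖z‖ := norm_pos_iff.2 hz0
    have h1 : ‖W z‖ ≤ κ * ‖fderiv ℝ V z‖ := by
      rw [hW, curl_eq_curlCLM, hκ]; exact ContinuousLinearMap.le_opNorm _ _
    have h2 : ‖fderiv ℝ V z‖ ≤ |C| / ‖z‖ := by
      refine (hC z hz0).trans ?_
      rw [div_le_div_iff₀ (by positivity) hzn]
      calc C * ‖z‖ ≤ |C| * ‖z‖ := mul_le_mul_of_nonneg_right (le_abs_self C) hzn.le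
        _ ≤ |C| * ‖z‖ ^ 2 := by
            refine mul_le_mul_of_nonneg_left ?_ (abs_nonneg C)
            nlinarith
    calc ‖W z‖ ≤ _ := h1
      _ ≤ κ * (|C| / ‖z‖) := mul_le_mul_of_nonneg_left h2 hκ0
      _ = _ := by ring
  -- `∂ₑ W = 0` off the apex: `∇W(z) v = (∇f(z) v) e` with `f = ⟪e, W⟫`, and `div W(z) = ∇f(z) e = 0`
  have hLW : ∀ z : EuclideanSpace ℝ (Fin 3), z ≠ 0 → fderiv ℝ W z e = 0 := by
    intro z hz
    set f : EuclideanSpace ℝ (Fin 3) → ℝ := fun w => ⟪e, W w⟫ with hf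
    have hfd : DifferentiableAt ℝ f z := (innerSL ℝ e).differentiableAt.comp z (hWd z hz)
    have hev : W =ᶠ[𝓝 z] fun w => f w • e := by
      filter_upwards [hopen.mem_nhds (show z ∈ ({0}ᶜ : Set (EuclideanSpace ℝ (Fin 3))) from hz)] with w hw
      exact hpar w hw
    have hDW : ∀ v, fderiv ℝ W z v = (fderiv ℝ f z v) • e := by
      intro v
      rw [hev.fderiv_eq, fderiv_smul_const hfd]
      simp
    -- `div W(z) = 0`
    have hdiv : VectorCalculus.divergence W z = 0 := by
      rw [hW]; exact HelicityDensityTransport.divergence_curl_eq_zero_of_contDiffAt (hC2 z hz)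
    rw [divergence_eq_sum_inner_fderiv (EuclideanSpace.basisFun (Fin 3) ℝ)] at hdiv
    simp only [EuclideanSpace.basisFun_apply, hDW, inner_smul_right, EuclideanSpace.inner_single_left, map_one,
      one_mul] at hdiv
    -- `Σᵢ (∇f eᵢ) eᵢ·e… = ∇f(e)` by expanding `e` in the basis
    have hexp : e = ∑ i : Fin 3, (e i) • EuclideanSpace.single i (1 : ℝ) := by
      conv_lhs => rw [← (EuclideanSpace.basisFun (Fin 3) ℝ).sum_repr e]
      simp [EuclideanSpace.basisFun_apply]
    have hfe : fderiv ℝ f z e = ∑ i : Fin 3, fderiv ℝ f z (EuclideanSpace.single i (1 : ℝ)) * e i := by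
      conv_lhs => rw [hexp]
      rw [map_sum]
      refine Finset.sum_congr rfl fun i _ => ?_
      rw [map_smul, smul_eq_mul, mul_comm]
    rw [hDW, hfe, hdiv, zero_smul]
  -- conclude with the half-line lemma
  exact eq_zero_offApex_of_fderiv_apply_eq_zero_of_farDecay he0 hWd hWdec hLW hy

end Summit.NavierStokesRegularity.NavierStokesRegularity.Theorems.QuietScarPocketDoor

end
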